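import Mathlib
import Summits.Ventures.PercRepro2.A3WithinCovariance

/-!
# The within-cluster inequality is a theorem, the between-cluster one is the residual — both in the
conditional-covariance language (blind cell PercRepro2, typer-1 g17; p5 g12's `A3FibreA.lean` /
`A3FibreMain.lean`; parts I–IV — part IV-c, corollaries only)

With `𝒢 = σ(C(a₃))` and `μ_A = (percMeasureOf p hp)[|A]`, parts IV-a/b read p5's within-cluster sum
`∑_W slack W / m_W` as `P(Q) · μ_Q[Cov(σ_b, F | 𝒢)] − P(PD) · μ_PD[Cov(1_{b∈U}, 1_{o∈U} | 𝒢)]`.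
p5's theorem `slack_nonneg` (BHK 1.4 on the `A`-fibres, Harris on the `T`/`T′`-fibres) therefore
says, in that language:

* **`within_nonneg`**: `P(PD) · μ_PD[Cov(1_{b∈U}, 1_{o∈U} | 𝒢)] ≤ P(Q) · μ_Q[Cov(σ_b, F | 𝒢)]` on
  every finite graph, weight vector and marking — the WITHIN-cluster half of the (HCOV) inequality
  `HCov_iff_covariance` is a theorem (p5's, restated);
* **`covariance_le_of_condExp_covariance_le`**: the BETWEEN-cluster half — the same inequality for
  the conditional means given `𝒢` (= (MEANS-a₃), `A3Between_iff_covariance'`) — implies the full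
  inequality `P(PD) · cov[1_{b∈U}, 1_{o∈U}; μ_PD] ≤ P(Q) · cov[σ_b, F; μ_Q]` (p5's
  `HCov_of_a3Between` through the two dictionaries; the converse is no theorem);
* **`covariance_sub_eq_within_add_between`**: the exact bookkeeping,
  `P(Q) · cov[σ_b, F; μ_Q] − P(PD) · cov[1_{b∈U}, 1_{o∈U}; μ_PD] = within + between`, `within ≥ 0`.

Corollaries of landed theorems only: nothing new is claimed about the residual (MEANS-a₃) or the crux.
-/

namespace Summit.Ventures.PercRepro2

open UnionCluster MeasureTheory ProbabilityTheory MeasureBridge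

namespace CovForm

namespace A3Means

section Corollaries

variable {V : Type*} {E : Type*} [Fintype V] [DecidableEq V] [Fintype E] [DecidableEq E]

/-- p5's within-cluster sum is nonnegative (`slack_nonneg` fibre by fibre, `m_W ≥ 0`). -/
lemma sum_slack_div_nonneg (p : E → ℝ) (hp : IsProbVec p) (ends : E → Sym2 V)
    (o a₁ a₂ a₃ b : V) :
    0 ≤ ∑ W : Finset V, A3Fibre.slack p ends o a₁ a₂ a₃ b W / A3Fibre.mW p ends a₁ a₂ a₃ W :=
  Finset.sum_nonneg fun W _ =>
    div_nonneg (A3Fibre.slack_nonneg p hp ends o a₁ a₂ a₃ b W) (prob_nonneg hp _)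

/-- **The within-cluster half of (HCOV) is a theorem**: on every finite graph, weight vector and
marking, `P(PD) · μ_PD[Cov(1_{b∈U}, 1_{o∈U} | 𝒢)] ≤ P(Q) · μ_Q[Cov(σ_b, F | 𝒢)]` with
`𝒢 = σ(C(a₃))` — p5's `slack_nonneg` (BHK 1.4 / Harris on the fibres of the revealed cluster) in
the conditional-covariance language. -/
theorem within_nonneg (p : E → ℝ) (hp : IsProbVec p) (ends : E → Sym2 V) (o a₁ a₂ a₃ b : V) :
    prob p (PDEvent ends a₁ a₂ a₃) *
        ∫ ω, condCovSigma (clusterSigma ends a₃) (inU ends a₁ a₂ b) (inU ends a₁ a₂ o)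
          ((percMeasureOf p hp)[|PDEvent ends a₁ a₂ a₃]) ω
          ∂((percMeasureOf p hp)[|PDEvent ends a₁ a₂ a₃]) ≤
      prob p (avoidAll ends a₂ {a₁}) *
        ∫ ω, condCovSigma (clusterSigma ends a₃) (sigma ends a₁ a₂ b)
          (Ffun ends o a₁ a₂ a₃ (gamma p ends o a₁ a₂ a₃))
          ((percMeasureOf p hp)[|avoidAll ends a₂ {a₁}]) ω
          ∂((percMeasureOf p hp)[|avoidAll ends a₂ {a₁}]) := by
  have h := sum_slack_div_nonneg p hp ends o a₁ a₂ a₃ b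
  rw [sum_slack_div_eq_integral_condCovSigma p hp] at h
  linarith

/-- **The between-cluster half implies the whole**: for `0 < P(Q)` and `0 < P(PD)`, the (HCOV)
inequality for the conditional means given `𝒢` (the residual (MEANS-a₃), `A3Between_iff_covariance'`)
implies the (HCOV) inequality itself (`HCov_iff_covariance`) — p5's `HCov_of_a3Between` through the
two dictionaries.  The converse is no theorem. -/
theorem covariance_le_of_condExp_covariance_le (p : E → ℝ) (hp : IsProbVec p) (ends : E → Sym2 V)
    (o a₁ a₂ a₃ b : V) (hQ : 0 < prob p (avoidAll ends a₂ {a₁}))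
    (hD : 0 < prob p (PDEvent ends a₁ a₂ a₃))
    (h : prob p (PDEvent ends a₁ a₂ a₃) *
          cov[((percMeasureOf p hp)[|PDEvent ends a₁ a₂ a₃])[inU ends a₁ a₂ b | clusterSigma ends a₃],
            ((percMeasureOf p hp)[|PDEvent ends a₁ a₂ a₃])[inU ends a₁ a₂ o | clusterSigma ends a₃];
            (percMeasureOf p hp)[|PDEvent ends a₁ a₂ a₃]] ≤
        prob p (avoidAll ends a₂ {a₁}) *
          cov[((percMeasureOf p hp)[|avoidAll ends a₂ {a₁}])[sigma ends a₁ a₂ b |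
              clusterSigma ends a₃],
            ((percMeasureOf p hp)[|avoidAll ends a₂ {a₁}])[Ffun ends o a₁ a₂ a₃
              (gamma p ends o a₁ a₂ a₃) | clusterSigma ends a₃];
            (percMeasureOf p hp)[|avoidAll ends a₂ {a₁}]]) :
    prob p (PDEvent ends a₁ a₂ a₃) *
        cov[inU ends a₁ a₂ b, inU ends a₁ a₂ o; (percMeasureOf p hp)[|PDEvent ends a₁ a₂ a₃]] ≤
      prob p (avoidAll ends a₂ {a₁}) *
        cov[sigma ends a₁ a₂ b, Ffun ends o a₁ a₂ a₃ (gamma p ends o a₁ a₂ a₃);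
          (percMeasureOf p hp)[|avoidAll ends a₂ {a₁}]] :=
  (HCov_iff_covariance p hp ends o a₁ a₂ a₃ b hQ hD).1
    (A3Fibre.HCov_of_a3Between hp ends o a₁ a₂ a₃ b
      ((A3Between_iff_covariance' p hp ends o a₁ a₂ a₃ b).2 h))

/-- **The exact bookkeeping**: `P(Q) · cov[σ_b, F; μ_Q] − P(PD) · cov[1_{b∈U}, 1_{o∈U}; μ_PD]`
is the within-cluster term (`≥ 0`, `within_nonneg`) plus the between-cluster term
(`= btw`, the residual (MEANS-a₃)) — `sum_slack_div_add_btw_eq_covariance` and `btw_eq_covariance'`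
read together. -/
theorem covariance_sub_eq_within_add_between (p : E → ℝ) (hp : IsProbVec p) (ends : E → Sym2 V)
    (o a₁ a₂ a₃ b : V) :
    prob p (avoidAll ends a₂ {a₁}) *
          cov[sigma ends a₁ a₂ b, Ffun ends o a₁ a₂ a₃ (gamma p ends o a₁ a₂ a₃);
            (percMeasureOf p hp)[|avoidAll ends a₂ {a₁}]] -
        prob p (PDEvent ends a₁ a₂ a₃) *
          cov[inU ends a₁ a₂ b, inU ends a₁ a₂ o; (percMeasureOf p hp)[|PDEvent ends a₁ a₂ a₃]] =
      (prob p (avoidAll ends a₂ {a₁}) *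
          ∫ ω, condCovSigma (clusterSigma ends a₃) (sigma ends a₁ a₂ b)
            (Ffun ends o a₁ a₂ a₃ (gamma p ends o a₁ a₂ a₃))
            ((percMeasureOf p hp)[|avoidAll ends a₂ {a₁}]) ω
            ∂((percMeasureOf p hp)[|avoidAll ends a₂ {a₁}]) -
        prob p (PDEvent ends a₁ a₂ a₃) *
          ∫ ω, condCovSigma (clusterSigma ends a₃) (inU ends a₁ a₂ b) (inU ends a₁ a₂ o)
            ((percMeasureOf p hp)[|PDEvent ends a₁ a₂ a₃]) ω
            ∂((percMeasureOf p hp)[|PDEvent ends a₁ a₂ a₃])) +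
      (prob p (avoidAll ends a₂ {a₁}) *
          cov[((percMeasureOf p hp)[|avoidAll ends a₂ {a₁}])[sigma ends a₁ a₂ b |
              clusterSigma ends a₃],
            ((percMeasureOf p hp)[|avoidAll ends a₂ {a₁}])[Ffun ends o a₁ a₂ a₃
              (gamma p ends o a₁ a₂ a₃) | clusterSigma ends a₃];
            (percMeasureOf p hp)[|avoidAll ends a₂ {a₁}]] -
        prob p (PDEvent ends a₁ a₂ a₃) *
          cov[((percMeasureOf p hp)[|PDEvent ends a₁ a₂ a₃])[inU ends a₁ a₂ b | clusterSigma ends a₃],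
            ((percMeasureOf p hp)[|PDEvent ends a₁ a₂ a₃])[inU ends a₁ a₂ o | clusterSigma ends a₃];
            (percMeasureOf p hp)[|PDEvent ends a₁ a₂ a₃]]) := by
  rw [← sum_slack_div_eq_integral_condCovSigma p hp, ← btw_eq_covariance' p hp,
    ← sum_slack_div_add_btw_eq_covariance p hp]

end Corollaries

end A3Means

end CovForm

end Summit.Ventures.PercRepro2
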